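import Literature.NumberTheory.Sieve.MatomakiRadziwillLemma11
import Literature.NumberTheory.LFunctions.ZetaScaleTwistedSum
import HarnessLib

/-!
# Matomäki–Radziwiłł 2016, Lemma 11 (Halász inequality for primes) from a zero-free region for `ζ` ALONE

Topic `NumberTheory/Sieve`.  Everything in this file is PROVED; no definitions, no named facts.

`MatomakiRadziwillLemma11.lean` proves the named fact `MatomakiRadziwill2016_lemma11` (K. Matomäki,
M. Radziwiłł, *Multiplicative functions in short intervals*, Ann. of Math. 183 (2016), Lemma 11:
`∑_{t ∈ 𝒯} |∑_{P ≤ p ≤ 2P} a_p p^{-it}|² ≪_ε (P + |𝒯| P exp(-log P/(log T)^{2/3+ε}) (log T)²) ∑_p |a_p|²/log P`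
for `1`-spaced `𝒯 ⊂ [-T, T]`) from a Vinogradov–Korobov zero-free region for ALL Dirichlet
`L`-functions (`MatomakiRadziwill2016_lemma11_of_vk : 0 < c → HasVKZeroFreeRegion c T₀ → …`).  The
printed proof uses "the zero-free region of the `ζ`-function" only (the explicit formula for
`∑ Λ(n) n^{it} f(n/P)` with the contour on `σ = 1 − c(log T)^{-2/3-ε}`), and in the tree's proof the
region enters at exactly one place, `TwistedVonMangoldt.exists_twistData_of_vk` for the LEVEL-ONE
character.  This file runs the same proof with that input replaced by
`ZetaScale.exists_twistData_one_of_scale` (`ZetaScaleTwistedSum.lean`), i.e. from scale-wise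
zero-freeness of `ζ₁` alone (the inline hypothesis `hZ`: for every `η > 2/3` and all large `X`,
`ζ₁(s) ≠ 0` on `|Im s| ≤ 3X`, `Re s ≥ 1 − (log X)^{-η}`), which any Vinogradov–Korobov region for `ζ`
supplies (`ZetaScale.scaleZeroFree_of_zetaRegion`, `…_of_ford`, `…_of_vk`):

* `MatomakiRadziwill2016_lemma11_of_scale : hZ → MatomakiRadziwill2016_lemma11`.

## References
* K. Matomäki, M. Radziwiłł, Ann. of Math. (2) 183 (2016), 1015–1056, doi:10.4007/annals.2016.183.3.6,
  Lemma 11 and its proof (arXiv:1501.04585, pp. 11–12). [cite: MatomakiRadziwillAnnals2016, Lemma 11]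
-/

noncomputable section

open Finset Complex Filter
open scoped ArithmeticFunction.vonMangoldt
open Literature.NumberTheory.LFunctions
open Literature.NumberTheory.LFunctions.TwistedRieszMean

namespace Literature.NumberTheory.Sieve

namespace MatomakiRadziwillL11

set_option maxHeartbeats 1600000 in
/-- **Matomäki–Radziwiłł 2016, Lemma 11, from a zero-free region for `ζ` alone** (scale-wise form `hZ`:
for every `η > 2/3` and all large `X`, `ζ₁(s) ≠ 0` on `|Im s| ≤ 3X`, `Re s ≥ 1 − (log X)^{-η}`).  For every
`ε > 0` there is `C` such that for `P, T ≥ 2`, every `1`-spaced `𝒯 ⊂ [-T, T]` and all coefficients `a_p`,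
`∑_{t ∈ 𝒯} |∑_{P ≤ p ≤ 2P} a_p p^{-it}|² ≤ C (P + |𝒯| P exp(-log P/(log T)^{2/3+ε}) (log T)²) ∑_p |a_p|²/log P`,
i.e. the named fact `MatomakiRadziwill2016_lemma11` holds.  Proof: that of
`MatomakiRadziwill2016_lemma11_of_vk` verbatim (duality in the weighted Halász–Montgomery form, the
trapezoid kernel `K(τ) = ∑ Λ(n) W_P(n) n^{-iτ}` evaluated by the Landau–Riesz contour engine), with the
`TwistData` at scale `X` now supplied by `ZetaScale.exists_twistData_one_of_scale`.
[cite: MatomakiRadziwillAnnals2016, Lemma 11] -/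
theorem _root_.Literature.NumberTheory.Sieve.MatomakiRadziwill2016_lemma11_of_scale
    (hZ : ∀ η : ℝ, 2 / 3 < η → ∀ᶠ X : ℝ in atTop, ∀ s : ℂ, |s.im| ≤ 3 * X →
      1 - Real.log X ^ (-η) ≤ s.re → riemannZeta₁ s ≠ 0) :
    MatomakiRadziwill2016_lemma11 := by
  intro ε hε
  classical
  -- exponents
  set ε' : ℝ := min ε (1 / 2) with hε'def
  have hε'0 : 0 < ε' := lt_min hε (by norm_num)
  have hε'ε : ε' ≤ ε := min_le_left _ _
  have hε'h : ε' ≤ 1 / 2 := min_le_right _ _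
  have hε'ne : ε' ≠ 0 := hε'0.ne'
  set η : ℝ := 2 / 3 + ε' / 2 with hηdef
  have hη23 : 2 / 3 < η := by rw [hηdef]; linarith
  have hη1 : η ≤ 1 := by rw [hηdef]; linarith
  have hη0 : 0 < η := by linarith
  -- the analytic input at a scale `X`, and the absolute Dirichlet-series bound `K₀`
  obtain ⟨C, hC0, hev⟩ := ZetaScale.exists_twistData_one_of_scale hZ one_pos hη23 hη1
  obtain ⟨K₀, hK₀, hKL⟩ := TwistedRieszMean.exists_norm_LSeries_le
  have hevX := (hev.and (eventually_mul_log_pow_three_le (2 * C))).and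
    ((Real.tendsto_log_atTop.eventually_ge_atTop (1 : ℝ)).and (eventually_ge_atTop (1 : ℝ)))
  obtain ⟨X₃, hX₃⟩ := Filter.eventually_atTop.1 hevX
  have hX₃1 : 1 ≤ X₃ := (hX₃ X₃ le_rfl).2.2
  set A₀ : ℝ := Real.log X₃ + Real.log 2 + Real.log (4 + K₀) with hA₀def
  -- thresholds in `L = log P` (case `log P > T`)
  have hevL := ((eventually_log_le_rpow_quarter.and
    (TwistedVonMangoldt.eventually_mul_rpow_le_exp (54 * C) (7 / 4) (show (0 : ℝ) < 1 / 12 by norm_num)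
      (show (0 : ℝ) < 3 / 4 by norm_num))).and
    ((eventually_ge_atTop (Real.exp A₀)).and ((eventually_ge_atTop (Real.log 16)).and
      (eventually_ge_atTop (4 : ℝ)))))
  obtain ⟨L₀, hL₀⟩ := Filter.eventually_atTop.1 hevL
  -- the threshold in `T`
  set T₀ : ℝ := max (Real.exp A₀) (max (Real.exp (18 ^ (2 / ε'))) (max (Real.exp (Real.exp 1))
    (Real.exp (Real.exp (max L₀ 0 / 2))))) with hT₀def
  have hT₀0 : 0 ≤ T₀ := le_trans (Real.exp_pos _).le (le_max_left _ _)
  -- the constant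
  set Cf : ℝ := 276 + 23 * (54 * C + 1) + 2 * Real.log 4 * (2 * T₀ + 1) + 2 * Real.log 4 with hCfdef
  have hlog4 : 0 ≤ Real.log 4 := Real.log_nonneg (by norm_num)
  have hprod : 0 ≤ Real.log 4 * T₀ := mul_nonneg hlog4 hT₀0
  have hCf1 : 276 ≤ Cf := by rw [hCfdef]; linarith
  have hCf2 : 23 * (54 * C + 1) ≤ Cf := by rw [hCfdef]; linarith
  have hCf3 : 2 * Real.log 4 * (2 * T₀ + 1) ≤ Cf := by rw [hCfdef]; linarith
  have hCf4 : 2 * Real.log 4 ≤ Cf := by rw [hCfdef]; linarith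
  have hCf0 : 0 ≤ Cf := le_trans (by norm_num) hCf1
  refine ⟨Cf, ?_⟩
  intro P T a 𝒯 hP hT h𝒯T hsep
  -- notation
  set S := (Icc ⌈P⌉₊ ⌊2 * P⌋₊).filter Nat.Prime with hSdef
  set Asum : ℝ := ∑ p ∈ S, ‖a p‖ ^ 2 / Real.log P with hAsumdef
  set lT : ℝ := Real.log T with hlTdef
  set lP : ℝ := Real.log P with hlPdef
  set E : ℝ := Real.exp (-(lP / lT ^ (2 / 3 + ε))) with hEdef
  set LHS : ℝ := ∑ t ∈ 𝒯, ‖∑ p ∈ S, a p * (p : ℂ) ^ (-((t : ℂ) * I))‖ ^ 2 with hLHSdef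
  have hP1 : 1 < P := by linarith
  have hP0 : 0 < P := by linarith
  have hlP0 : 0 < lP := Real.log_pos hP1
  have hlT0 : 0 < lT := Real.log_pos (by linarith)
  have hE0 : 0 < E := Real.exp_pos _
  have hAsum0 : 0 ≤ Asum := Finset.sum_nonneg fun p _ => div_nonneg (sq_nonneg _) hlP0.le
  have hcard : (#𝒯 : ℝ) ≤ 2 * T + 1 := card_le_of_wellSpaced (by linarith) h𝒯T hsep
  have hcard0 : (0 : ℝ) ≤ #𝒯 := Nat.cast_nonneg _
  have hRHS0 : 0 ≤ (#𝒯 : ℝ) * P * E * lT ^ 2 := by positivity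
  change LHS ≤ Cf * (P + (#𝒯 : ℝ) * P * E * lT ^ 2) * Asum
  have htb : LHS ≤ (#𝒯 : ℝ) * (2 * Real.log 4 * P) * Asum := trivial_bound hP1 a 𝒯
  by_cases hmain : 2 * T₀ + 1 < (#𝒯 : ℝ) ∧ E * lT ^ 2 < 1
  · -- **the main regime**
    obtain ⟨hcardT₀, hEsmall⟩ := hmain
    have hTT₀ : T₀ < T := by linarith
    have hT1 : 1 ≤ T := by linarith
    -- consequences of `T > T₀`
    have hTexp : ∀ y : ℝ, Real.exp y ≤ T₀ → y < lT := fun y hy => by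
      rw [hlTdef, Real.lt_log_iff_exp_lt (by linarith)]; linarith
    have hlTA₀ : A₀ < lT := hTexp _ (le_max_left _ _)
    have hlT18 : (18 : ℝ) ^ (2 / ε') < lT := hTexp _ ((le_max_left _ _).trans (le_max_right _ _))
    have hlTe : Real.exp 1 < lT :=
      hTexp _ (((le_max_left _ _).trans (le_max_right _ _)).trans (le_max_right _ _))
    have hlTL₀ : Real.exp (max L₀ 0 / 2) < lT :=
      hTexp _ (((le_max_right _ _).trans (le_max_right _ _)).trans (le_max_right _ _))
    have hlT1 : 1 ≤ lT := by have := Real.add_one_le_exp (1 : ℝ); linarith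
    have hllT1 : 1 < Real.log lT := by
      rw [Real.lt_log_iff_exp_lt hlT0]; exact hlTe
    have h18 : 18 ≤ lT ^ (ε' / 2) := by
      have h' : ((18 : ℝ) ^ (2 / ε')) ^ (ε' / 2) ≤ lT ^ (ε' / 2) :=
        Real.rpow_le_rpow (by positivity) hlT18.le (by positivity)
      rwa [← Real.rpow_mul (by norm_num), show 2 / ε' * (ε' / 2) = 1 by field_simp,
        Real.rpow_one] at h'
    -- `u` and the lower bound for `log P`
    set u : ℝ := lP / lT ^ (2 / 3 + ε) with hudef
    have hu : 2 * Real.log lT < u := by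
      apply two_mul_log_lt_of_exp_mul_sq_lt hlT0
      exact hEsmall
    have hu0 : 0 ≤ u := by linarith
    have hpow1 : 1 ≤ lT ^ (2 / 3 + ε) := Real.one_le_rpow hlT1 (by linarith)
    have hlPu : u ≤ lP := by
      have : lP = u * lT ^ (2 / 3 + ε) := by
        rw [hudef, div_mul_cancel₀ _ (by positivity)]
      rw [this]
      exact le_mul_of_one_le_right hu0 hpow1
    have hlPlb : 2 * Real.log lT < lP := lt_of_lt_of_le hu hlPu
    have hloglT : max L₀ 0 / 2 < Real.log lT := by
      rw [Real.lt_log_iff_exp_lt hlT0]; exact hlTL₀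
    have hlPL₀ : max L₀ 0 < lP := by linarith
    have hL₀P := hL₀ lP ((le_max_left _ _).trans hlPL₀.le)
    obtain ⟨⟨hlogquarter, hexp74⟩, hA₀lP, h16, hlP4⟩ := hL₀P
    have hP16 : 16 ≤ P := by
      rw [hlPdef, Real.le_log_iff_exp_le hP0] at h16
      -- `h16 : exp (log 16) ≤ P`
      simpa [Real.exp_log (show (0 : ℝ) < 16 by norm_num)] using h16
    have hP4 : 4 ≤ P := by linarith
    have hlP1 : 1 ≤ lP := by linarith
    have hllPA₀ : A₀ ≤ Real.log lP := by
      rw [Real.le_log_iff_exp_le hlP0]; exact hA₀lP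
    -- the scale `X`
    set LP : ℝ := 2 * lP + 2 + K₀ with hLPdef
    have hLP2 : 2 ≤ LP := by rw [hLPdef]; linarith
    set X : ℝ := max X₃ (2 * T * LP) with hXdef
    have hX₃X : X₃ ≤ X := le_max_left _ _
    obtain ⟨⟨hTDX, hClogX⟩, hlogX1, hX1⟩ := hX₃ X hX₃X
    have hX0 : 0 < X := by linarith
    have hX2T : 2 * T * LP ≤ X := le_max_right _ _
    have h2TX : 2 * T ≤ X :=
      le_trans (le_mul_of_one_le_right (by linarith) (by linarith : (1 : ℝ) ≤ LP)) hX2T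
    -- `TwistData` for every shift `t - t'`
    have hTD : ∀ t ∈ 𝒯, ∀ t' ∈ 𝒯,
        TwistData (TwistedVonMangoldt.twist (1 : DirichletCharacter ℂ 1) (t - t'))
          (TwistedVonMangoldt.G (1 : DirichletCharacter ℂ 1) (t - t'))
          (TwistedVonMangoldt.delta (1 : DirichletCharacter ℂ 1)) (1 - ((t - t' : ℝ) : ℂ) * I)
          (1 - Real.log X ^ (-η) / 2) X (C * Real.log X ^ 3) := by
      intro t ht t' ht'
      have hτ : |t - t'| ≤ X := by
        calc |t - t'| ≤ |t| + |t'| := abs_sub _ _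
          _ ≤ T + T := add_le_add (h𝒯T t ht) (h𝒯T t' ht')
          _ ≤ X := by linarith
      have hq : ((1 : ℕ) : ℝ) ≤ Real.log X ^ (1 : ℝ) := by
        rw [Real.rpow_one, Nat.cast_one]; exact hlogX1
      exact hTDX 1 hq 1 rfl (t - t') hτ X hX1 le_rfl
    -- the uniform part `U` of the kernel bound
    set F₀ : ℝ := 2 * (C * Real.log X ^ 3) * (P / 2) ^ ((1 - Real.log X ^ (-η) / 2) - 1) with hF₀def
    have hF₀0 : 0 ≤ F₀ := by rw [hF₀def]; positivity
    set U : ℝ := 1 / T + F₀ with hUdef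
    have hU0 : 0 ≤ U := by rw [hUdef]; positivity
    have h2T0 : (0 : ℝ) < 2 * T := by linarith
    have hU : LP / X + F₀ + 2 * (C * Real.log X ^ 3) / X ^ 2 ≤ U := by
      have h1 : LP / X ≤ 1 / (2 * T) := by
        rw [div_le_div_iff₀ hX0 h2T0]
        linarith
      have h2 : 2 * (C * Real.log X ^ 3) / X ^ 2 ≤ 1 / (2 * T) := by
        rw [div_le_div_iff₀ (pow_pos hX0 2) h2T0]
        calc 2 * (C * Real.log X ^ 3) * (2 * T) = (2 * C * Real.log X ^ 3) * (2 * T) := by ring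
          _ ≤ X * (2 * T) := mul_le_mul_of_nonneg_right hClogX h2T0.le
          _ ≤ X * X := mul_le_mul_of_nonneg_left h2TX hX0.le
          _ = 1 * X ^ 2 := by ring
      have h3 : 1 / (2 * T) + 1 / (2 * T) = 1 / T := by ring
      rw [hUdef, ← h3]
      linarith
    -- **the Dirichlet-polynomial bound with the parameter `U`**
    have hDB : LHS ≤ 23 * P * (6 + (#𝒯 : ℝ) * U) * Asum :=
      dirichlet_bound hsep hTD hK₀ hKL hP16 hU0 hU a
    -- the saving in exponential form and the size of `log X`
    have hF₀exp : F₀ = 2 * C * Real.log X ^ 3 *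
        Real.exp (-(Real.log (P / 2) * (Real.log X ^ (-η) / 2))) := by
      rw [hF₀def, rpow_sigma_eq hP0]; ring
    have hlogX : Real.log X ≤ A₀ + lT + Real.log lP := by
      have h1 := log_scale_le hX₃1 hT1 (by linarith : (1 : ℝ) ≤ LP)
      have h2 := log_LP_le hlP1 hK₀
      rw [hXdef, hA₀def]
      linarith
    have hcard3 : (#𝒯 : ℝ) * (1 / T) ≤ 3 := by
      rw [mul_one_div, div_le_iff₀ (by linarith)]; linarith
    by_cases hcase : Real.log lP ≤ lT
    · -- **case (i): `log P ≤ T`**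
      have hlogX3 : Real.log X ≤ 3 * lT := by linarith
      have hsave := saving_case_i hP4 hlogX1 hlogX3 hlT1 hη0 hη1
      have hA := key_exponent_ineq hlT1 h18 hηdef hε'ε hudef hu0
      have hnum := numerics_case_i hC0 hlT1 hu hA
      have hF₀le : F₀ ≤ (54 * C + 1) * lT ^ 2 * E := by
        have h1 : Real.log X ^ 3 ≤ (3 * lT) ^ 3 := pow_le_pow_left₀ (by linarith) hlogX3 3
        calc F₀ = 2 * C * Real.log X ^ 3 *
              Real.exp (-(Real.log (P / 2) * (Real.log X ^ (-η) / 2))) := hF₀exp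
          _ ≤ 2 * C * (3 * lT) ^ 3 * Real.exp (-(lP / (12 * lT ^ η))) := by
              refine mul_le_mul ?_ hsave (Real.exp_pos _).le (by positivity)
              exact mul_le_mul_of_nonneg_left h1 (by positivity)
          _ = 54 * C * lT ^ 3 * Real.exp (-(lP / (12 * lT ^ η))) := by ring
          _ ≤ (54 * C + 1) * lT ^ 2 * Real.exp (-u) := hnum
          _ = (54 * C + 1) * lT ^ 2 * E := by simp only [hEdef, hudef]
      have hTU : (#𝒯 : ℝ) * U ≤ 3 + (54 * C + 1) * ((#𝒯 : ℝ) * E * lT ^ 2) := by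
        rw [hUdef, mul_add]
        have : (#𝒯 : ℝ) * F₀ ≤ (#𝒯 : ℝ) * ((54 * C + 1) * lT ^ 2 * E) :=
          mul_le_mul_of_nonneg_left hF₀le hcard0
        linarith
      calc LHS ≤ 23 * P * (6 + (#𝒯 : ℝ) * U) * Asum := hDB
        _ ≤ 23 * P * (9 + (54 * C + 1) * ((#𝒯 : ℝ) * E * lT ^ 2)) * Asum := by
            apply mul_le_mul_of_nonneg_right _ hAsum0
            apply mul_le_mul_of_nonneg_left _ (by positivity)
            linarith
        _ = (207 * P + 23 * (54 * C + 1) * ((#𝒯 : ℝ) * P * E * lT ^ 2)) * Asum := by ring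
        _ ≤ (Cf * P + Cf * ((#𝒯 : ℝ) * P * E * lT ^ 2)) * Asum := by
            apply mul_le_mul_of_nonneg_right _ hAsum0
            apply add_le_add
            · exact mul_le_mul_of_nonneg_right (le_trans (by norm_num) hCf1) hP0.le
            · exact mul_le_mul_of_nonneg_right hCf2 hRHS0
        _ = Cf * (P + (#𝒯 : ℝ) * P * E * lT ^ 2) * Asum := by ring
    · -- **case (ii): `log P > T`**
      push Not at hcase
      have hllP3 : 1 ≤ 3 * Real.log lP := by linarith
      have hlogX3 : Real.log X ≤ 3 * Real.log lP := by linarith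
      have hsave := saving_case_ii hP4 hlogX1 hlogX3 hllP3 hη0 hη1
      have hnum := numerics_case_ii hC0 (by linarith : (1 : ℝ) < lP) hlogquarter hexp74
      have hF₀le : F₀ ≤ 1 / T := by
        have h1 : Real.log X ^ 3 ≤ (3 * Real.log lP) ^ 3 := pow_le_pow_left₀ (by linarith) hlogX3 3
        have hTlP : T < lP := by
          calc T = Real.exp lT := (Real.exp_log (by linarith)).symm
            _ < Real.exp (Real.log lP) := Real.exp_lt_exp.2 hcase
            _ = lP := Real.exp_log hlP0
        calc F₀ = 2 * C * Real.log X ^ 3 *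
              Real.exp (-(Real.log (P / 2) * (Real.log X ^ (-η) / 2))) := hF₀exp
          _ ≤ 2 * C * (3 * Real.log lP) ^ 3 * Real.exp (-(lP / (12 * Real.log lP))) := by
              refine mul_le_mul ?_ hsave (Real.exp_pos _).le (by positivity)
              exact mul_le_mul_of_nonneg_left h1 (by positivity)
          _ = 54 * C * Real.log lP ^ 3 * Real.exp (-(lP / (12 * Real.log lP))) := by ring
          _ ≤ 1 / lP := hnum
          _ ≤ 1 / T := one_div_le_one_div_of_le (by linarith) hTlP.le
      have hTU : (#𝒯 : ℝ) * U ≤ 6 := by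
        rw [hUdef, mul_add]
        have : (#𝒯 : ℝ) * F₀ ≤ (#𝒯 : ℝ) * (1 / T) := mul_le_mul_of_nonneg_left hF₀le hcard0
        linarith
      calc LHS ≤ 23 * P * (6 + (#𝒯 : ℝ) * U) * Asum := hDB
        _ ≤ 23 * P * 12 * Asum := by
            apply mul_le_mul_of_nonneg_right _ hAsum0
            apply mul_le_mul_of_nonneg_left _ (by positivity)
            linarith
        _ = 276 * P * Asum := by ring
        _ ≤ Cf * (P + (#𝒯 : ℝ) * P * E * lT ^ 2) * Asum := by
            apply mul_le_mul_of_nonneg_right _ hAsum0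
            calc 276 * P ≤ Cf * P := mul_le_mul_of_nonneg_right hCf1 hP0.le
              _ ≤ Cf * (P + (#𝒯 : ℝ) * P * E * lT ^ 2) :=
                  mul_le_mul_of_nonneg_left (by linarith) hCf0
  · -- **the trivial regimes**: few points, or the second term dominates
    rcases not_and_or.1 hmain with h1 | h2
    · push Not at h1
      calc LHS ≤ (#𝒯 : ℝ) * (2 * Real.log 4 * P) * Asum := htb
        _ ≤ (2 * T₀ + 1) * (2 * Real.log 4 * P) * Asum := by
            apply mul_le_mul_of_nonneg_right _ hAsum0
            exact mul_le_mul_of_nonneg_right h1 (by positivity)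
        _ = (2 * Real.log 4 * (2 * T₀ + 1)) * P * Asum := by ring
        _ ≤ Cf * P * Asum := by
            apply mul_le_mul_of_nonneg_right _ hAsum0
            exact mul_le_mul_of_nonneg_right hCf3 hP0.le
        _ ≤ Cf * (P + (#𝒯 : ℝ) * P * E * lT ^ 2) * Asum := by
            apply mul_le_mul_of_nonneg_right _ hAsum0
            exact mul_le_mul_of_nonneg_left (by linarith) hCf0
    · push Not at h2
      calc LHS ≤ (#𝒯 : ℝ) * (2 * Real.log 4 * P) * Asum := htb
        _ ≤ (#𝒯 : ℝ) * (2 * Real.log 4 * P) * (E * lT ^ 2) * Asum := by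
            apply mul_le_mul_of_nonneg_right _ hAsum0
            exact le_mul_of_one_le_right (by positivity) h2
        _ = 2 * Real.log 4 * ((#𝒯 : ℝ) * P * E * lT ^ 2) * Asum := by ring
        _ ≤ Cf * ((#𝒯 : ℝ) * P * E * lT ^ 2) * Asum := by
            apply mul_le_mul_of_nonneg_right _ hAsum0
            exact mul_le_mul_of_nonneg_right hCf4 hRHS0
        _ ≤ Cf * (P + (#𝒯 : ℝ) * P * E * lT ^ 2) * Asum := by
            apply mul_le_mul_of_nonneg_right _ hAsum0
            exact mul_le_mul_of_nonneg_left (by linarith) hCf0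

end MatomakiRadziwillL11

end Literature.NumberTheory.Sieve
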